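import Mathlib
import Summits.CriticalPhenomena.PercolationContinuityZ3.Theorems.PercNearOneGluingNoHeavyLowerTailFatMinorityThreePorts
import Summits.CriticalPhenomena.PercolationContinuityZ3.Theorems.PercNearOneGluingNoHeavyLowerTailFatMinorityAveragedCertificate
import HarnessLib

/-!
# `NoHeavyLowerTail` (stmt-CriticalPhenomena-4575), line fat-minority-linear — the RESIDUAL of the (UT4, QUT4) induction as one Lean hypothesis:
# averaged hybrid one-port certificates in the Case-II instances (route task `nh-dp-fatminority`, gen 11; FINDINGS-fat-minority-gen11 §2, §6)

Notation of `…FatMinorityInduction`, `…FatMinorityAveragedCertificate`.  After gen 11 the up-set star inequality TARGET (UT4 + QUT4, every admissible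
threshold) is a kernel theorem for observers with `≤ 3` ports (`upsetStar_target_card_le_three`) and, for every port count, is reduced to its
Case-II / no-singleton instances (`upsetStar_target_of_caseII`).  The exact censuses (ttrl2, 86 M instances at `|P| ≥ 4`) leave exactly one family
of proof-shaped statements alive there: HYBRID-cell one-port certificates, averaged over the ports with weights `q` (the pivotality weights
`q_a ∝ μ₁ᵃ(U) − μ₀ᵃ(U)`, or a single port: hybrid-∃).

`upsetStar_target_of_averagedCertificates`: if in every Case-II instance (strict at every port, no singleton member of `𝒰`, `|A| ≥ 4`) SOME
probability vector `q` on the ports, some anchor `a₀` and some cell selectors satisfy the averaged hybrid certificate inequality of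
`upsetStar_of_averagedCertificate`, then TARGET holds for every weighting, port set, up-set and admissible threshold.  (For `|A| ≤ 3` no hypothesis is
needed: `caseII_target_U2` / `target_of_commonPort_caseII`.)  This is the precise statement the remaining conjecture of the line has to supply.
No definitions.
-/

namespace Summit.CriticalPhenomena.PercolationContinuityZ3.Theorems

open MeasureTheory Set
open Literature.Probability.LatticeModels (prodBernoulli)
open Literature.Probability.Percolation

noncomputable section
open scoped Classical

variable {n : ℕ}

/-- **TARGET from averaged hybrid certificates in the Case-II instances with at least four ports.**  See the module docstring.
[cite: KozmaNitzan2024, Thm. 4 p. 13, Lemma 3 p. 6, Lemma 4 p. 9, Lemma 5 p. 13; VandenbergHaggstromKahn2005, Thm. 1.4/1.5 (p. 7); reduction: route notes gen 9/11] -/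
theorem upsetStar_target_of_averagedCertificates (o b : Fin n)
    (hCert : ∀ (w : Sym2 (Fin n) → unitInterval) (A : Finset (Fin n)) (c : Fin n) (𝒰 : Finset (Finset (Fin n))) (t : ℝ),
      o ∉ A → (∀ u, u ≠ o → u ∉ A → w s(o, u) = 0) → w s(o, o) = 0 → c ≠ o → 4 ≤ A.card →
      𝒰 ⊆ A.powerset → ∅ ∉ 𝒰 → (∀ B ∈ 𝒰, ∀ B' ∈ A.powerset, B ⊆ B' → B' ∈ 𝒰) →
      (∀ z ∈ A, ({z} : Finset (Fin n)) ∉ 𝒰) →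
      (∀ z ∈ A, (prodBernoulli (Function.update w s(o, z) 1)).real (openConn c b) <
        (prodBernoulli (Function.update w s(o, z) 1)).real (openConn z b)) →
      0 ≤ t → (∀ v ∈ A, (prodBernoulli w).real (openConn c b) - (prodBernoulli w).real (openConn v b) ≤ t) →
      ∃ (a₀ : Fin n) (q : Fin n → ℝ) (v u : Fin n → Finset (Fin n) → Fin n),
        a₀ ≠ o ∧ (∀ a ∈ A, 0 ≤ q a) ∧ ∑ a ∈ A, q a = 1 ∧
        (∀ a ∈ A, ∀ B ∈ 𝒰, a ∉ B → v a B ∈ B) ∧ (∀ a ∈ A, ∀ B ∈ 𝒰, a ∉ B → u a B ∈ B) ∧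
        (∀ a ∈ A, ∀ B ∈ 𝒰, a ∉ B → (prodBernoulli w).real (openConnIn ({o}ᶜ : Set (Fin n)) a₀ b) ≤
          (prodBernoulli w).real (openConnIn ({o}ᶜ : Set (Fin n)) (u a B) b)) ∧
        ∑ a ∈ A, q a *
          ((if (prodBernoulli (Function.update w s(o, a) 1)).real (openConn c a)ᶜ = 0 then 0 else
              (w s(o, a) : ℝ) *
                  (prodBernoulli (Function.update w s(o, a) 1)).real
                    ((openConn c a)ᶜ ∩ ({ω | s(o, a) ∈ ω} ∩ {ω | ∃ B ∈ 𝒰, ∀ u ∈ B, s(o, u) ∈ ω})) *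
                  ((prodBernoulli (Function.update w s(o, a) 1)).real (openConn c b) -
                    (prodBernoulli (Function.update w s(o, a) 1)).real (openConn a b)) /
                (prodBernoulli (Function.update w s(o, a) 1)).real (openConn c a)ᶜ) +
            ∑ B ∈ 𝒰.filter (fun B => a ∉ B),
              min (max 0 ((prodBernoulli w).real (openConnIn ({o}ᶜ : Set (Fin n)) c b) -
                    (prodBernoulli w).real (openConnIn ({o}ᶜ : Set (Fin n)) (v a B) b)) *
                  (prodBernoulli w).real (starEvent o (↑B : Set (Fin n))))
                ((prodBernoulli w).real (openConn c b ∩ starEvent o (↑B : Set (Fin n))) -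
                  (prodBernoulli w).real (openConn a₀ b ∩ starEvent o (↑B : Set (Fin n))))) ≤
        t * (prodBernoulli w).real {ω | ∃ B ∈ 𝒰, ∀ u ∈ B, s(o, u) ∈ ω})
    (k : ℕ) :
    ∀ (w : Sym2 (Fin n) → unitInterval) (A : Finset (Fin n)), A.card ≤ k → o ∉ A →
      (∀ u, u ≠ o → u ∉ A → w s(o, u) = 0) → w s(o, o) = 0 →
      ∀ 𝒰 : Finset (Finset (Fin n)), 𝒰 ⊆ A.powerset → ∅ ∉ 𝒰 →
        (∀ B ∈ 𝒰, ∀ B' ∈ A.powerset, B ⊆ B' → B' ∈ 𝒰) →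
        ∀ c : Fin n, c ≠ o → ∀ t : ℝ, 0 ≤ t →
          (∀ v ∈ A, (prodBernoulli w).real (openConn c b) - (prodBernoulli w).real (openConn v b) ≤ t) →
          (prodBernoulli w).real (openConn c b ∩ {ω | ∃ B ∈ 𝒰, ∀ u ∈ B, s(o, u) ∈ ω}) -
              (prodBernoulli w).real (openConn o b ∩ {ω | ∃ B ∈ 𝒰, ∀ u ∈ B, s(o, u) ∈ ω}) ≤
            t * (prodBernoulli w).real {ω | ∃ B ∈ 𝒰, ∀ u ∈ B, s(o, u) ∈ ω} := by
  refine upsetStar_target_of_caseII o b ?_ k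
  intro w A c 𝒰 t hoA hiso hloop hco h𝒰A h0 hup hsing hII ht hgap
  by_cases hA : A.card ≤ 3
  · -- at most three ports: no hypothesis needed (THEOREM B)
    exact upsetStar_target_card_le_three w A o b c hA hoA hiso hloop 𝒰 h𝒰A h0 hup hco t ht hgap
  · have hA4 : 4 ≤ A.card := by omega
    obtain ⟨a₀, q, v, u, ha₀o, hq0, hq1, hv, hu, hanchor, hcert⟩ :=
      hCert w A c 𝒰 t hoA hiso hloop hco hA4 h𝒰A h0 hup hsing hII ht hgap
    exact upsetStar_of_averagedCertificate w A o c b a₀ hoA hco ha₀o hiso 𝒰 h𝒰A hup v hv u hu hanchor q hq0 hq1 t hcert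

end

end Summit.CriticalPhenomena.PercolationContinuityZ3.Theorems
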